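import Literature.InformationTheory.QuantumCodes.CSSPhenomenologicalThreshold
import Literature.InformationTheory.QuantumCodes.CSSErasureThreshold
import Literature.InformationTheory.QuantumCodes.HypergraphProductDistance
import Literature.InformationTheory.QuantumCodes.HypergraphProductWeights
import HarnessLib

/-!
# Certified thresholds for hypergraph-product families; the planar surface codes
# `HGP(repetition, repetition)` as an explicit weight-4 instance

Topic `Literature/InformationTheory/QuantumCodes` (venture QEC, LADDER-QEC rung Q5, "LDPC families beyond the
toric code"; qec-lit-2 gen 3). PROVED, no named fact, kernel axioms. This file makes the tree's generic
Dumer–Kovalev–Pryadko threshold theorems (`IrreducibleCountingThreshold.lean` code capacity,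
`CSSErasureThreshold.lean` erasures, `CSSPhenomenologicalThreshold.lean` noisy measurement) usable for code
families indexed by ARBITRARY finite types (the hypergraph product's qubits are `(E₁ × V₂) ⊕ (V₁ × E₂)`, not
`Fin n`), feeds them with the Tillich–Zémor distance theorem `HypergraphProduct.min_le_hammingNorm_of_cycle`
(TZ Thm 9, proved in the tree) and the row-weight bound `hammingNorm_xMatrix_row_le`, and instantiates
everything on the simplest explicit family: the hypergraph product of the repetition code `[n+1, 1, n+1]`
(parity-check matrix `H`, `n × (n+1)`) with its transpose hypergraph `Hᵀ` — Tillich–Zémor's first example,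
the PLANAR SURFACE CODE with boundaries (`(n+1)² + n²` qubits, one logical qubit, `X`-checks of weight `≤ 4`,
distance of the `H_X`-detected sector `≥ min(d(ker H), d(ker Hᵀ)) = min(n+1, ∞) = n+1`).

Results (one error type: the errors detected by `H_X = xMatrix`, trivial iff in `rowsp H_Z = rowSpace zMatrix`):
* type-family threshold forms `codeCapacityThreshold_of_rowWeight'`, `erasureThreshold_of_rowWeight'`,
  `phenomThreshold_of_rowWeight'` (sizes `|V_i|`, any index types);
* `HypergraphProduct.card_rowSupp_xMatrix_le` (`≤ w₁ + w₂`), `HypergraphProduct.le_hammingNorm_of_cycle`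
  (`d ≤ ‖e‖` on `ker H_X ∖ rowsp H_Z` when `d ≤ d₁, d₂`);
* the repetition code: `repMatrix n`, `repMatrix_mulVec_apply`, `eq_of_repMatrix_mulVec_eq_zero` (cycles are
  constant), `le_minDist_pcCode_repMatrix` (`d ≥ n+1`), `hammingNorm_repMatrix_row_le` / `_col_le` (`≤ 2`),
  `repMatrix_transpose_mulVec_castSucc`, `pcCode_repMatrix_transpose_eq_bot` (`ker Hᵀ = 0`, `dᵀ = ∞`);
* the planar family `planarHX k`, `planarSZ k` (`n = k+1`): `card_rowSupp_planarHX_le` (`≤ 4`),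
  `le_hammingNorm_of_planar_cycle` (`≥ k+2`), `card_planarQubit` (`= (k+2)² + (k+1)²`), and the three certified
  thresholds `planar_codeCapacityThreshold` (`36 p(1-p) < 1`, i.e. `p < p₀(3) ≈ .0286`, every minimum-weight
  decoder family), `planar_erasureThreshold` (`y < 1/3`), `planar_phenomThreshold` (`100 p(1-p) < 1`, `q = p`,
  polynomially many rounds, every minimum-weight space-time decoder family).

## References

* [TillichZemor2014] J.-P. Tillich, G. Zémor, IEEE Trans. IT 60 (2014) 1193, Thm 9 and §3 (the product of
  two repetition codes is the planar surface code; arXiv:0903.0566v1).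
* [DumerKovalevPryadko2015] I. Dumer, A. A. Kovalev, L. P. Pryadko, PRL 115 (2015) 050502, Thm 2, Thm 3, p. 5.
* [DennisEtAl2002] E. Dennis, A. Kitaev, A. Landahl, J. Preskill, J. Math. Phys. 43 (2002) 4452, §5.3.
-/

namespace Literature.InformationTheory.QuantumCodes

open Finset Matrix Filter Topology

/-! ### Threshold theorems for families indexed by arbitrary finite types -/

section TypeFamily

variable {Q C : ℕ → Type*} [∀ i, Fintype (Q i)] [∀ i, DecidableEq (Q i)]

open Classical in
/-- **Code-capacity threshold, type-family form** (DKP15 Thm 2 at `y = 0`): checks of weight `≤ w`,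
`1 ≤ d_i ≤` distance, `|Q_i| r^{d_i} → 0` for all `0 < r < 1`, ANY minimum-weight decoders; then
`4(w-1)² p(1-p) < 1` ⇒ `Prob_fail → 0`. [cite: DumerKovalevPryadko2015, Thm 2 (y = 0)] -/
theorem codeCapacityThreshold_of_rowWeight' (H : ∀ i, Matrix (C i) (Q i) (ZMod 2))
    (SX : ∀ i, Submodule (ZMod 2) (Q i → ZMod 2)) (D : ∀ i, Decoder (C i → ZMod 2) (Q i → ZMod 2))
    (hD : ∀ i, (D i).IsMinWeight (fun e => H i *ᵥ e) {x | H i *ᵥ x = 0} hammingNorm)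
    {w : ℕ} (hw : 2 ≤ w) (hrow : ∀ i j, (rowSupp (H i) j).card ≤ w) (d : ℕ → ℕ) (hd1 : ∀ i, 1 ≤ d i)
    (hd : ∀ i (x : Q i → ZMod 2), H i *ᵥ x = 0 → x ∉ SX i → d i ≤ hammingNorm x)
    (hgrowth : ∀ r : ℝ, 0 < r → r < 1 →
      Tendsto (fun i => (Fintype.card (Q i) : ℝ) * r ^ d i) atTop (𝓝 0))
    {p : ℝ} (hp0 : 0 ≤ p) (hp : p ≤ 1 / 2) (h4 : 4 * ((w - 1 : ℕ) : ℝ) ^ 2 * (p * (1 - p)) < 1) :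
    Tendsto (fun i => ∑ e ∈ univ.filter (fun e : Q i → ZMod 2 =>
        ¬ (D i).Corrects (fun e => H i *ᵥ e) (SX i : Set (Q i → ZMod 2)) e), bernoulliWeight p (supp e))
      atTop (𝓝 0) := by
  set K : ℝ := ((w - 1 : ℕ) : ℝ) with hK
  have hK1 : 1 ≤ K := by
    rw [hK]
    exact_mod_cast (show 1 ≤ w - 1 by omega)
  have hK0 : 0 < K := by linarith
  set s : ℝ := Real.sqrt (p * (1 - p)) with hs
  have hs0 : 0 ≤ s := Real.sqrt_nonneg _
  have hpp : 0 ≤ p * (1 - p) := mul_nonneg hp0 (by linarith)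
  set r : ℝ := 2 * K * s with hrdef
  have hr0 : 0 ≤ r := by positivity
  have hr1 : r < 1 := by
    have hsq : r ^ 2 = 4 * K ^ 2 * (p * (1 - p)) := by
      rw [hrdef, mul_pow, mul_pow, hs, Real.sq_sqrt hpp]
      ring
    have h : r ^ 2 < 1 := by rw [hsq]; exact h4
    have := (sq_lt_one_iff_abs_lt_one r).1 h
    rwa [abs_of_nonneg hr0] at this
  have h1r : 0 < 1 - r := by linarith
  have hp1 : p ≤ 1 := by linarith
  have hbound : ∀ i, ∑ e ∈ univ.filter (fun e : Q i → ZMod 2 =>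
        ¬ (D i).Corrects (fun e => H i *ᵥ e) (SX i : Set (Q i → ZMod 2)) e), bernoulliWeight p (supp e) ≤
      (Fintype.card (Q i) : ℝ) * r ^ d i / (K * (1 - r)) := by
    intro i
    have h := sum_not_corrects_bernoulli_le_of_rowWeight (H i) (SX i) (hD i) hw (hrow i) (hd1 i) (hd i)
      hp0 hp (by rw [← hK, ← hs]; exact hr1)
    rw [← hK, ← hs] at h
    exact h
  have hnonneg : ∀ i, 0 ≤ ∑ e ∈ univ.filter (fun e : Q i → ZMod 2 =>
        ¬ (D i).Corrects (fun e => H i *ᵥ e) (SX i : Set (Q i → ZMod 2)) e), bernoulliWeight p (supp e) :=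
    fun i => Finset.sum_nonneg fun e _ => bernoulliWeight_nonneg hp0 hp1 _
  have hQ : Tendsto (fun i => (Fintype.card (Q i) : ℝ) * r ^ d i / (K * (1 - r))) atTop (𝓝 0) := by
    rcases hr0.eq_or_lt with hr00 | hrpos
    · have : (fun i => (Fintype.card (Q i) : ℝ) * r ^ d i / (K * (1 - r))) = fun _ => 0 := by
        funext i
        rw [← hr00, zero_pow (by have := hd1 i; omega)]
        simp
      rw [this]
      exact tendsto_const_nhds
    · have h := (hgrowth r hrpos hr1).div_const (K * (1 - r))
      simpa using h
  exact squeeze_zero hnonneg hbound hQ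

/-- **Erasure threshold, type-family form** (DKP15 Thm 2, erasure part): `(w-1) y < 1` ⇒ the
probability that the erasure pattern is uncorrectable `→ 0`. [cite: DumerKovalevPryadko2015, Thm 2 (erasure part)] -/
theorem erasureThreshold_of_rowWeight' (H : ∀ i, Matrix (C i) (Q i) (ZMod 2))
    (SX : ∀ i, Submodule (ZMod 2) (Q i → ZMod 2))
    {w : ℕ} (hw : 2 ≤ w) (hrow : ∀ i j, (rowSupp (H i) j).card ≤ w) (d : ℕ → ℕ) (hd1 : ∀ i, 1 ≤ d i)
    (hd : ∀ i (x : Q i → ZMod 2), H i *ᵥ x = 0 → x ∉ SX i → d i ≤ hammingNorm x)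
    (hgrowth : ∀ r : ℝ, 0 < r → r < 1 →
      Tendsto (fun i => (Fintype.card (Q i) : ℝ) * r ^ d i) atTop (𝓝 0))
    {y : ℝ} (hy0 : 0 ≤ y) (hy : ((w - 1 : ℕ) : ℝ) * y < 1) :
    Tendsto (fun i => ErasureDecoder.uncorrectableProb {x : Q i → ZMod 2 | H i *ᵥ x = 0}
      (SX i : Set (Q i → ZMod 2)) y) atTop (𝓝 0) := by
  classical
  set K : ℝ := ((w - 1 : ℕ) : ℝ) with hK
  have hK1 : 1 ≤ K := by
    rw [hK]
    exact_mod_cast (show 1 ≤ w - 1 by omega)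
  have hK0 : 0 < K := by linarith
  set r : ℝ := K * y with hrdef
  have hr0 : 0 ≤ r := by positivity
  have hr1 : r < 1 := hy
  have h1r : 0 < 1 - r := by linarith
  have hy1 : y ≤ 1 := by nlinarith
  have hbound : ∀ i, ErasureDecoder.uncorrectableProb {x : Q i → ZMod 2 | H i *ᵥ x = 0}
      (SX i : Set (Q i → ZMod 2)) y ≤ (Fintype.card (Q i) : ℝ) * r ^ d i / (K * (1 - r)) := by
    intro i
    have h := uncorrectableProb_le (H i) (SX i) hw (hrow i) (hd1 i) (hd i) hy0 hy1 (by rw [← hK]; exact hr1)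
    rw [← hK] at h
    exact h
  have hnonneg : ∀ i, 0 ≤ ErasureDecoder.uncorrectableProb {x : Q i → ZMod 2 | H i *ᵥ x = 0}
      (SX i : Set (Q i → ZMod 2)) y :=
    fun i => ErasureDecoder.uncorrectableProb_nonneg _ _ hy0 hy1
  have hQ : Tendsto (fun i => (Fintype.card (Q i) : ℝ) * r ^ d i / (K * (1 - r))) atTop (𝓝 0) := by
    rcases hr0.eq_or_lt with hr00 | hrpos
    · have : (fun i => (Fintype.card (Q i) : ℝ) * r ^ d i / (K * (1 - r))) = fun _ => 0 := by
        funext i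
        rw [← hr00, zero_pow (by have := hd1 i; omega)]
        simp
      rw [this]
      exact tendsto_const_nhds
    · have h := (hgrowth r hrpos hr1).div_const (K * (1 - r))
      simpa using h
  exact squeeze_zero hnonneg hbound hQ

/-- **Phenomenological threshold, type-family form** (`q = p`, DKP15 "`w → w + 2`"): checks of weight
`≤ w`, `(|Q_i| + |C_i|) T_i r^{d_i} → 0` for all `0 < r < 1`, ANY minimum-weight space-time decoders; then
`4(w+1)² p(1-p) < 1` ⇒ `Prob_fail → 0`. [cite: DumerKovalevPryadko2015, Thm 3 with p. 5 (w → w + 2)] -/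
theorem phenomThreshold_of_rowWeight' [∀ i, Fintype (C i)] [∀ i, DecidableEq (C i)]
    (H : ∀ i, Matrix (C i) (Q i) (ZMod 2))
    (SX : ∀ i, Submodule (ZMod 2) (Q i → ZMod 2)) (T : ℕ → ℕ)
    (D : ∀ i, CSSPhenom.STDecoder (C i) (Q i) (T i))
    (hD : ∀ i, (D i).IsMinWeight (CSSPhenom.stSyn (H i) (T i)) (CSSPhenom.stCycles (H i) (T i)) hammingNorm)
    {w : ℕ} (hrow : ∀ i j, (rowSupp (H i) j).card ≤ w) (d : ℕ → ℕ) (hd1 : ∀ i, 1 ≤ d i)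
    (hd : ∀ i (x : Q i → ZMod 2), H i *ᵥ x = 0 → x ∉ SX i → d i ≤ hammingNorm x)
    (hgrowth : ∀ r : ℝ, 0 < r → r < 1 →
      Tendsto (fun i => (((Fintype.card (Q i) + Fintype.card (C i)) * T i : ℕ) : ℝ) * r ^ d i)
        atTop (𝓝 0))
    {p : ℝ} (hp0 : 0 ≤ p) (hp : p ≤ 1 / 2) (h4 : 4 * ((w + 1 : ℕ) : ℝ) ^ 2 * (p * (1 - p)) < 1) :
    Tendsto (fun i => CSSPhenom.phenomFailureProb (H i) (T i) (SX i : Set (Q i → ZMod 2)) (D i) p p)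
      atTop (𝓝 0) := by
  classical
  set K : ℝ := ((w + 1 : ℕ) : ℝ) with hK
  have hK1 : 1 ≤ K := by
    rw [hK]
    exact_mod_cast (show 1 ≤ w + 1 by omega)
  have hK0 : 0 < K := by linarith
  set s : ℝ := Real.sqrt (p * (1 - p)) with hs
  have hs0 : 0 ≤ s := Real.sqrt_nonneg _
  have hpp : 0 ≤ p * (1 - p) := mul_nonneg hp0 (by linarith)
  set r : ℝ := 2 * K * s with hrdef
  have hr0 : 0 ≤ r := by positivity
  have hr1 : r < 1 := by
    have hsq : r ^ 2 = 4 * K ^ 2 * (p * (1 - p)) := by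
      rw [hrdef, mul_pow, mul_pow, hs, Real.sq_sqrt hpp]
      ring
    have h : r ^ 2 < 1 := by rw [hsq]; exact h4
    have := (sq_lt_one_iff_abs_lt_one r).1 h
    rwa [abs_of_nonneg hr0] at this
  have h1r : 0 < 1 - r := by linarith
  have hp1 : p ≤ 1 := by linarith
  have hbound : ∀ i, CSSPhenom.phenomFailureProb (H i) (T i) (SX i : Set (Q i → ZMod 2)) (D i) p p ≤
      (((Fintype.card (Q i) + Fintype.card (C i)) * T i : ℕ) : ℝ) * r ^ d i / (K * (1 - r)) := by
    intro i
    have h := CSSPhenom.phenomFailureProb_le_of_rowWeight (SX i) (hD i) (hrow i) (hd1 i) (hd i) hp0 hp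
      (by rw [← hK, ← hs]; exact hr1)
    rw [← hK, ← hs] at h
    exact h
  have hnonneg : ∀ i, 0 ≤ CSSPhenom.phenomFailureProb (H i) (T i) (SX i : Set (Q i → ZMod 2)) (D i) p p := by
    intro i
    unfold CSSPhenom.phenomFailureProb
    refine Finset.sum_nonneg fun E _ => ?_
    rw [ToricCode.phenomenologicalWeight_self]
    exact bernoulliWeight_nonneg hp0 hp1 _
  have hQ : Tendsto (fun i => (((Fintype.card (Q i) + Fintype.card (C i)) * T i : ℕ) : ℝ) * r ^ d i /
      (K * (1 - r))) atTop (𝓝 0) := by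
    rcases hr0.eq_or_lt with hr00 | hrpos
    · have : (fun i => (((Fintype.card (Q i) + Fintype.card (C i)) * T i : ℕ) : ℝ) * r ^ d i /
          (K * (1 - r))) = fun _ => 0 := by
        funext i
        rw [← hr00, zero_pow (by have := hd1 i; omega)]
        simp
      rw [this]
      exact tendsto_const_nhds
    · have h := (hgrowth r hrpos hr1).div_const (K * (1 - r))
      simpa using h
  exact squeeze_zero hnonneg hbound hQ

end TypeFamily

/-! ### Hypergraph products: row weights and distance in the cluster vocabulary -/

section RowSupp

variable {ι V : Type*} [Fintype V]

/-- The number of qubits in a check equals the Hamming weight of its row ("generator weights not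
exceeding `w`" = row weights). [cite: DumerKovalevPryadko2015, Thm 2 (generator weights w_X, w_Z)] -/
theorem card_rowSupp_eq_hammingNorm (H : Matrix ι V (ZMod 2)) (i : ι) :
    (rowSupp H i).card = hammingNorm (H i) := by
  classical
  simp only [rowSupp, hammingNorm]

end RowSupp

namespace HypergraphProduct

variable {V₁ E₁ V₂ E₂ : Type*} [Fintype V₁] [Fintype E₁] [Fintype V₂] [Fintype E₂]
  [DecidableEq V₁] [DecidableEq E₁] [DecidableEq V₂] [DecidableEq E₂]

/-- **Check weights of `H_X` of a hypergraph product**: if the rows of `H₁` have weight `≤ w₁` and those of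
`H₂` weight `≤ w₂`, every `X`-check of `HGP(H₁, H₂)` involves at most `w₁ + w₂` qubits.
[cite: TillichZemor2014, Thm 1 (row weights of the form i + j)] -/
theorem card_rowSupp_xMatrix_le (H₁ : Matrix V₁ E₁ (ZMod 2)) (H₂ : Matrix V₂ E₂ (ZMod 2)) {w₁ w₂ : ℕ}
    (h₁ : ∀ a, hammingNorm (H₁ a) ≤ w₁) (h₂ : ∀ b, hammingNorm (H₂ b) ≤ w₂) (x : V₁ × V₂) :
    (rowSupp (xMatrix H₁ H₂) x).card ≤ w₁ + w₂ := by
  rw [card_rowSupp_eq_hammingNorm]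
  obtain ⟨a, b⟩ := x
  exact (hammingNorm_xMatrix_row_le H₁ H₂ a b).trans (Nat.add_le_add (h₁ a) (h₂ b))

/-- **Distance of the `H_X`-detected sector of a hypergraph product** (from Tillich–Zémor Thm 9, cycle
half): if `d ≤ d(ker H₁)` and `d ≤ d(ker H₂)`, every vector of `ker H_X ∖ rowsp H_Z` has weight `≥ d`.
[cite: TillichZemor2014, Thm 9 (arXiv v1 chunk p0008 L11-45)] -/
theorem le_hammingNorm_of_cycle (H₁ : Matrix V₁ E₁ (ZMod 2)) (H₂ : Matrix V₂ E₂ (ZMod 2)) {d : ℕ}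
    (hd₁ : (d : ℕ∞) ≤ Coding.minDist (pcCode H₁)) (hd₂ : (d : ℕ∞) ≤ Coding.minDist (pcCode H₂))
    (e : (E₁ × V₂) ⊕ (V₁ × E₂) → ZMod 2) (he : xMatrix H₁ H₂ *ᵥ e = 0)
    (hne : e ∉ rowSpace (zMatrix H₁ H₂)) : d ≤ hammingNorm e := by
  have h := min_le_hammingNorm_of_cycle H₁ H₂ (e := e) he hne
  have h' : (d : ℕ∞) ≤ (hammingNorm e : ℕ∞) := (le_min hd₁ hd₂).trans h
  exact_mod_cast h'

/-- **Check weights of `H_Z` of a hypergraph product**: if the columns of `H₁` have weight `≤ c₁` and those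
of `H₂` weight `≤ c₂`, every `Z`-check of `HGP(H₁, H₂)` involves at most `c₁ + c₂` qubits.
[cite: TillichZemor2014, §3-§4 (|C_{αβ}| = |α| + |β|)] -/
theorem card_rowSupp_zMatrix_le (H₁ : Matrix V₁ E₁ (ZMod 2)) (H₂ : Matrix V₂ E₂ (ZMod 2)) {c₁ c₂ : ℕ}
    (h₁ : ∀ α, hammingNorm (fun a => H₁ a α) ≤ c₁) (h₂ : ∀ β, hammingNorm (fun b => H₂ b β) ≤ c₂)
    (x : E₁ × E₂) : (rowSupp (zMatrix H₁ H₂) x).card ≤ c₁ + c₂ := by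
  rw [card_rowSupp_eq_hammingNorm]
  obtain ⟨α, β⟩ := x
  exact (hammingNorm_zMatrix_row_le H₁ H₂ α β).trans (Nat.add_le_add (h₁ α) (h₂ β))

/-- **Distance of the `H_Z`-detected sector of a hypergraph product** (Tillich–Zémor Thm 9, cocycle half):
if `d ≤ d(ker H₁ᵀ)` and `d ≤ d(ker H₂ᵀ)`, every vector of `ker H_Z ∖ rowsp H_X` has weight `≥ d`.
[cite: TillichZemor2014, Thm 9 (arXiv v1 chunk p0008 L46-50)] -/
theorem le_hammingNorm_of_cocycle (H₁ : Matrix V₁ E₁ (ZMod 2)) (H₂ : Matrix V₂ E₂ (ZMod 2)) {d : ℕ}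
    (hd₁ : (d : ℕ∞) ≤ Coding.minDist (pcCode H₁ᵀ)) (hd₂ : (d : ℕ∞) ≤ Coding.minDist (pcCode H₂ᵀ))
    (e : (E₁ × V₂) ⊕ (V₁ × E₂) → ZMod 2) (he : zMatrix H₁ H₂ *ᵥ e = 0)
    (hne : e ∉ rowSpace (xMatrix H₁ H₂)) : d ≤ hammingNorm e := by
  have h := min_le_hammingNorm_of_cocycle H₁ H₂ (e := e) he hne
  have h' : (d : ℕ∞) ≤ (hammingNorm e : ℕ∞) := (le_min hd₁ hd₂).trans h
  exact_mod_cast h'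

end HypergraphProduct

/-! ### The repetition code -/

section Repetition

/-- Parity-check matrix of the **repetition code** of length `n+1`: check `i` compares bits `i` and `i+1`.
[cite: TillichZemor2014, §3 (the repetition code as the cycle code of a path)] -/
def repMatrix (n : ℕ) : Matrix (Fin n) (Fin (n + 1)) (ZMod 2) :=
  Matrix.of fun i j => if j = i.castSucc ∨ j = i.succ then 1 else 0

/-- The repetition checks: `(H x)_i = x_i + x_{i+1}`. [cite: TillichZemor2014, §3 (repetition code)] -/
theorem repMatrix_mulVec_apply (n : ℕ) (x : Fin (n + 1) → ZMod 2) (i : Fin n) :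
    (repMatrix n *ᵥ x) i = x i.castSucc + x i.succ := by
  classical
  have hne : i.castSucc ≠ i.succ := (Fin.castSucc_lt_succ (i := i)).ne
  simp only [mulVec, dotProduct, repMatrix, of_apply]
  have hre : ∀ j : Fin (n + 1), (if j = i.castSucc ∨ j = i.succ then (1 : ZMod 2) else 0) * x j =
      if j = i.castSucc ∨ j = i.succ then x j else 0 := by
    intro j
    split_ifs <;> simp
  rw [Finset.sum_congr rfl fun j _ => hre j, ← Finset.sum_filter]
  have hset : univ.filter (fun j : Fin (n + 1) => j = i.castSucc ∨ j = i.succ) = {i.castSucc, i.succ} := by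
    ext j
    simp [Finset.mem_filter]
  rw [hset, Finset.sum_pair hne]

/-- **A cycle of the repetition code is constant.** [cite: TillichZemor2014, §3 (repetition code: the cycle code is {0, 𝟙})] -/
theorem eq_of_repMatrix_mulVec_eq_zero (n : ℕ) {x : Fin (n + 1) → ZMod 2} (hx : repMatrix n *ᵥ x = 0)
    (j : Fin (n + 1)) : x j = x 0 := by
  induction j using Fin.induction with
  | zero => rfl
  | succ i ih =>
    have h := congrFun hx i
    rw [repMatrix_mulVec_apply, Pi.zero_apply] at h
    have key : ∀ a b : ZMod 2, a + b = 0 → b = a := by decide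
    rw [key _ _ h, ih]

/-- **The repetition code `[n+1, 1, n+1]` has distance `≥ n+1`** (a non-zero constant vector has full
weight). [cite: TillichZemor2014, §3 (repetition code)] -/
theorem le_minDist_pcCode_repMatrix (n : ℕ) :
    ((n + 1 : ℕ) : ℕ∞) ≤ Coding.minDist (pcCode (repMatrix n)) := by
  classical
  rw [Coding.le_minDist_iff]
  intro c hc hc0
  have hconst := eq_of_repMatrix_mulVec_eq_zero n ((mem_pcCode_iff _ _).1 hc)
  have h0 : c 0 ≠ 0 := by
    intro h0
    apply hc0
    funext j
    rw [hconst j, h0, Pi.zero_apply]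
  have hall : hammingNorm c = n + 1 := by
    unfold hammingNorm
    rw [Finset.filter_true_of_mem fun j _ => by rw [hconst j]; exact h0, Finset.card_univ, Fintype.card_fin]
  exact_mod_cast hall.ge

/-- The repetition checks have weight `≤ 2`. [cite: TillichZemor2014, §3 (repetition code)] -/
theorem hammingNorm_repMatrix_row_le (n : ℕ) (i : Fin n) : hammingNorm (repMatrix n i) ≤ 2 := by
  classical
  refine (HypergraphProduct.hammingNorm_le_card_of_subset (repMatrix n i) {i.castSucc, i.succ}
    fun j hj => ?_).trans Finset.card_le_two
  by_contra hmem
  apply hj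
  simp only [Finset.mem_insert, Finset.mem_singleton, not_or] at hmem
  simp [repMatrix, hmem.1, hmem.2]

/-- The bits of the repetition code lie in `≤ 2` checks (column weights `≤ 2`; rows of `Hᵀ`).
[cite: TillichZemor2014, §3 (repetition code)] -/
theorem hammingNorm_repMatrix_col_le (n : ℕ) (j : Fin (n + 1)) : hammingNorm ((repMatrix n)ᵀ j) ≤ 2 := by
  classical
  refine (HypergraphProduct.hammingNorm_le_card_of_subset ((repMatrix n)ᵀ j)
    (univ.filter fun i : Fin n => j = i.castSucc ∨ j = i.succ) fun i hi => ?_).trans ?_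
  · rw [mem_filter]
    refine ⟨mem_univ _, ?_⟩
    by_contra h
    apply hi
    simp only [transpose_apply, repMatrix, of_apply]
    rw [if_neg h]
  · rw [Finset.filter_or]
    refine (card_union_le _ _).trans ?_
    have h1 : (univ.filter fun i : Fin n => j = i.castSucc).card ≤ 1 := by
      rw [Finset.card_le_one]
      intro a ha b hb
      rw [mem_filter] at ha hb
      exact Fin.castSucc_injective _ (ha.2.symm.trans hb.2)
    have h2 : (univ.filter fun i : Fin n => j = i.succ).card ≤ 1 := by
      rw [Finset.card_le_one]
      intro a ha b hb
      rw [mem_filter] at ha hb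
      exact Fin.succ_injective _ (ha.2.symm.trans hb.2)
    omega

/-- `Hᵀ` of the repetition code at bit `i < n`: `(Hᵀ y)_i = y_i + y_{i-1}` (`y_{-1} := 0`).
[cite: TillichZemor2014, §3 (repetition code; the transpose hypergraph)] -/
theorem repMatrix_transpose_mulVec_castSucc (n : ℕ) (y : Fin n → ZMod 2) (i : Fin n) :
    ((repMatrix n)ᵀ *ᵥ y) i.castSucc = y i + if h : 0 < (i : ℕ) then y ⟨(i : ℕ) - 1, by omega⟩ else 0 := by
  classical
  simp only [mulVec, dotProduct, transpose_apply, repMatrix, of_apply]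
  have hre : ∀ i' : Fin n, (if i.castSucc = i'.castSucc ∨ i.castSucc = i'.succ then (1 : ZMod 2) else 0) * y i' =
      if i.castSucc = i'.castSucc ∨ i.castSucc = i'.succ then y i' else 0 := by
    intro i'
    split_ifs <;> simp
  rw [Finset.sum_congr rfl fun i' _ => hre i']
  by_cases h0 : 0 < (i : ℕ)
  · set ip : Fin n := ⟨(i : ℕ) - 1, by omega⟩ with hip_def
    have hip : (ip : ℕ) = (i : ℕ) - 1 := rfl
    rw [dif_pos h0]
    have hne : ip ≠ i := fun h => by have hv : (ip : ℕ) = i := congrArg Fin.val h; omega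
    rw [← Finset.sum_erase_add _ _ (Finset.mem_univ i),
      ← Finset.sum_erase_add _ _ (Finset.mem_erase.2 ⟨hne, Finset.mem_univ _⟩)]
    rw [Finset.sum_eq_zero]
    · simp only [true_or, if_true, zero_add]
      rw [if_pos]
      · ring
      · exact Or.inr (Fin.ext (show (i : ℕ) = (ip : ℕ) + 1 by omega))
    · intro i' hi'
      rw [Finset.mem_erase, Finset.mem_erase] at hi'
      rw [if_neg]
      rintro (h | h)
      · exact hi'.2.1 (Fin.castSucc_injective _ h).symm
      · have hv : (i : ℕ) = (i' : ℕ) + 1 := congrArg Fin.val h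
        exact hi'.1 (Fin.ext (show (i' : ℕ) = ip by omega))
  · rw [dif_neg h0, add_zero]
    rw [Finset.sum_eq_single i]
    · simp
    · intro i' _ hi'
      rw [if_neg]
      rintro (h | h)
      · exact hi' (Fin.castSucc_injective _ h).symm
      · have hv : (i : ℕ) = (i' : ℕ) + 1 := congrArg Fin.val h
        omega
    · intro h; exact absurd (Finset.mem_univ i) h

/-- **`ker Hᵀ = 0` for the repetition code** (the checks are linearly independent): `Hᵀ y = 0` forces
`y_0 = 0` and then `y_{i} = y_{i-1}` successively. [cite: TillichZemor2014, §3 (repetition code; dᵀ = ∞)] -/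
theorem eq_zero_of_repMatrix_transpose_mulVec (n : ℕ) {y : Fin n → ZMod 2} (hy : (repMatrix n)ᵀ *ᵥ y = 0) :
    y = 0 := by
  have hstep : ∀ i : Fin n, y i + (if h : 0 < (i : ℕ) then y ⟨(i : ℕ) - 1, by omega⟩ else 0) = 0 := by
    intro i
    rw [← repMatrix_transpose_mulVec_castSucc, hy, Pi.zero_apply]
  funext i
  rw [Pi.zero_apply]
  obtain ⟨k, hk⟩ := i
  induction k using Nat.strong_induction_on with
  | _ k ih =>
    have h := hstep ⟨k, hk⟩
    by_cases h0 : 0 < k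
    · rw [dif_pos h0] at h
      have hprev := ih (k - 1) (by omega) (by omega)
      rw [hprev, add_zero] at h
      exact h
    · rw [dif_neg h0, add_zero] at h
      exact h

/-- The code with parity-check matrix `Hᵀ` (repetition code) is zero: `dᵀ = ∞`.
[cite: TillichZemor2014, §3 and §5 (minimum distance of the zero code is ∞)] -/
theorem pcCode_repMatrix_transpose_eq_bot (n : ℕ) : pcCode (repMatrix n)ᵀ = ⊥ := by
  rw [Submodule.eq_bot_iff]
  intro y hy
  exact eq_zero_of_repMatrix_transpose_mulVec n ((mem_pcCode_iff _ _).1 hy)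

end Repetition

/-! ### The planar surface codes `HGP(rep, rep)` and their certified thresholds -/

section Planar

/-- Qubits of the `k`-th planar surface code (`n = k+1`): the edges `(E₁ × V₂) ⊕ (V₁ × E₂)` of the product of
the path hypergraph `H` (`V₁ = Fin (k+1)` checks, `E₁ = Fin (k+2)` bits) with its transpose `Hᵀ`
(`V₂ = Fin (k+2)`, `E₂ = Fin (k+1)`): `(k+2)² + (k+1)²` qubits.
[cite: TillichZemor2014, §3 (product of a repetition code with its transpose = planar / surface code)] -/
abbrev PlanarQubit (k : ℕ) : Type := (Fin (k + 2) × Fin (k + 2)) ⊕ (Fin (k + 1) × Fin (k + 1))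

/-- `X`-checks (vertices `V₁ × V₂`) of the `k`-th planar surface code. [cite: TillichZemor2014, §3] -/
abbrev PlanarCheck (k : ℕ) : Type := Fin (k + 1) × Fin (k + 2)

/-- `H_X` of the planar surface code `HGP(H, Hᵀ)`, `H` the `(k+1) × (k+2)` repetition parity-check matrix.
[cite: TillichZemor2014, §3-§4 (H_X of the product hypergraph)] -/
def planarHX (k : ℕ) : Matrix (PlanarCheck k) (PlanarQubit k) (ZMod 2) :=
  HypergraphProduct.xMatrix (repMatrix (k + 1)) (repMatrix (k + 1))ᵀ

/-- The trivial errors of this sector: the row space of `H_Z` of the planar surface code.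
[cite: TillichZemor2014, §3-§4 (H_Z of the product hypergraph)] -/
def planarSZ (k : ℕ) : Submodule (ZMod 2) (PlanarQubit k → ZMod 2) :=
  rowSpace (HypergraphProduct.zMatrix (repMatrix (k + 1)) (repMatrix (k + 1))ᵀ)

/-- The planar `X`-checks have weight `≤ 4` (`2` from a row of `H`, `2` from a column of `H`).
[cite: TillichZemor2014, Thm 1 (row weights i + j; here 2 + 2)] -/
theorem card_rowSupp_planarHX_le (k : ℕ) (x : PlanarCheck k) : (rowSupp (planarHX k) x).card ≤ 4 :=
  HypergraphProduct.card_rowSupp_xMatrix_le _ _ (hammingNorm_repMatrix_row_le (k + 1))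
    (hammingNorm_repMatrix_col_le (k + 1)) x

/-- **Distance `≥ k+2`** of this sector of the `k`-th planar surface code (Tillich–Zémor Thm 9 with
`d₁ = k+2`, `d₂ = d(ker Hᵀ) = ∞`). [cite: TillichZemor2014, Thm 9] -/
theorem le_hammingNorm_of_planar_cycle (k : ℕ) (x : PlanarQubit k → ZMod 2) (hx : planarHX k *ᵥ x = 0)
    (hxS : x ∉ planarSZ k) : k + 2 ≤ hammingNorm x :=
  HypergraphProduct.le_hammingNorm_of_cycle _ _ (le_minDist_pcCode_repMatrix (k + 1))
    (by rw [pcCode_repMatrix_transpose_eq_bot, Coding.minDist_bot]; exact le_top) x hx hxS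

/-- The `k`-th planar surface code has `(k+2)² + (k+1)²` qubits. [cite: TillichZemor2014, §3 (edge count of the product)] -/
theorem card_planarQubit (k : ℕ) : Fintype.card (PlanarQubit k) = (k + 2) ^ 2 + (k + 1) ^ 2 := by
  simp only [Fintype.card_sum, Fintype.card_prod, Fintype.card_fin]
  ring

/-- The `k`-th planar surface code has `(k+1)(k+2)` `X`-checks. [cite: TillichZemor2014, §3 (vertex count of the product)] -/
theorem card_planarCheck (k : ℕ) : Fintype.card (PlanarCheck k) = (k + 1) * (k + 2) := by
  simp only [Fintype.card_prod, Fintype.card_fin]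

/-- The row sums of the repetition checks vanish (`2 = 0` in `𝔽₂`). [cite: TillichZemor2014, §3 (repetition code)] -/
theorem sum_repMatrix_row (n : ℕ) (i : Fin n) : ∑ j, repMatrix n i j = 0 := by
  have h := repMatrix_mulVec_apply n (fun _ => (1 : ZMod 2)) i
  simp only [mulVec, dotProduct, mul_one] at h
  rw [h]
  decide

/-- A vertical `X̄`-string of the planar code: the edges `(α, 0)`, `α ∈ E₁`, of type `E_R`.
[cite: TillichZemor2014, §3 (logical operators of the surface code)] -/
def planarXString (k : ℕ) : PlanarQubit k → ZMod 2 :=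
  Sum.elim (fun αb => if αb.2 = 0 then 1 else 0) (fun _ => 0)

/-- A horizontal `Z̄`-string of the planar code: the edges `(0, b)`, `b ∈ V₂`, of type `E_R`.
[cite: TillichZemor2014, §3 (logical operators of the surface code)] -/
def planarZString (k : ℕ) : PlanarQubit k → ZMod 2 :=
  Sum.elim (fun αb => if αb.1 = 0 then 1 else 0) (fun _ => 0)

/-- The `X̄`-string is undetectable: `H_X x̄ = 0`. [cite: TillichZemor2014, §3 (surface code)] -/
theorem planarHX_mulVec_planarXString (k : ℕ) : planarHX k *ᵥ planarXString k = 0 := by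
  classical
  funext x
  obtain ⟨a, b⟩ := x
  rw [Pi.zero_apply]
  simp only [mulVec, dotProduct, planarHX, planarXString, Fintype.sum_sum_type, Sum.elim_inl,
    Sum.elim_inr, mul_zero, Finset.sum_const_zero, add_zero, Fintype.sum_prod_type,
    HypergraphProduct.xMatrix_apply_inl]
  -- `Σ_α Σ_b' H₁ a α [b = b'] [b' = 0] = [b = 0] Σ_α H₁ a α = 0`
  have hinner : ∀ α : Fin (k + 2), (∑ b' : Fin (k + 2),
      repMatrix (k + 1) a α * (if b = b' then 1 else 0) * (if b' = 0 then (1 : ZMod 2) else 0)) =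
        repMatrix (k + 1) a α * (if b = 0 then 1 else 0) := by
    intro α
    rw [Finset.sum_eq_single b]
    · simp
    · intro b' _ hb'
      rw [if_neg (Ne.symm hb'), mul_zero, zero_mul]
    · intro h; exact absurd (Finset.mem_univ b) h
  rw [Finset.sum_congr rfl fun α _ => hinner α, ← Finset.sum_mul, sum_repMatrix_row, zero_mul]

/-- The `Z̄`-string is a `Z`-cycle: `H_Z z̄ = 0`. [cite: TillichZemor2014, §3 (surface code)] -/
theorem planarHZ_mulVec_planarZString (k : ℕ) :
    HypergraphProduct.zMatrix (repMatrix (k + 1)) (repMatrix (k + 1))ᵀ *ᵥ planarZString k = 0 := by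
  classical
  funext x
  obtain ⟨α, β⟩ := x
  rw [Pi.zero_apply]
  simp only [mulVec, dotProduct, planarZString, Fintype.sum_sum_type, Sum.elim_inl, Sum.elim_inr, mul_zero,
    Finset.sum_const_zero, add_zero, Fintype.sum_prod_type, HypergraphProduct.zMatrix_apply_inl,
    transpose_apply]
  -- `Σ_α' Σ_b [α = α'] H₂ b β [α' = 0] = [α = 0] Σ_b Hᵀ b β = [α = 0] Σ_b H β b = 0`
  have hswap : (∑ α' : Fin (k + 2), ∑ b : Fin (k + 2),
      (if α = α' then (1 : ZMod 2) else 0) * repMatrix (k + 1) β b * (if α' = 0 then 1 else 0)) =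
        (if α = 0 then 1 else 0) * ∑ b : Fin (k + 2), repMatrix (k + 1) β b := by
    rw [Finset.sum_eq_single α]
    · simp only [if_true, one_mul]
      rw [Finset.mul_sum]
      refine Finset.sum_congr rfl fun b _ => ?_
      ring
    · intro α' _ hα'
      refine Finset.sum_eq_zero fun b _ => ?_
      rw [if_neg (Ne.symm hα'), zero_mul, zero_mul]
    · intro h; exact absurd (Finset.mem_univ α) h
  rw [hswap, sum_repMatrix_row, mul_zero]

/-- The two strings meet in exactly one qubit: `x̄ · z̄ = 1`. [cite: TillichZemor2014, §3 (surface code)] -/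
theorem planarXString_dotProduct_planarZString (k : ℕ) : planarXString k ⬝ᵥ planarZString k = 1 := by
  classical
  simp only [dotProduct, planarXString, planarZString, Fintype.sum_sum_type, Sum.elim_inl, Sum.elim_inr,
    mul_zero, Finset.sum_const_zero, add_zero, Fintype.sum_prod_type]
  rw [Finset.sum_eq_single (0 : Fin (k + 2))]
  · rw [Finset.sum_eq_single (0 : Fin (k + 2))]
    · simp
    · intro b _ hb
      simp [hb]
    · intro h; exact absurd (Finset.mem_univ _) h
  · intro α _ hα
    refine Finset.sum_eq_zero fun b _ => ?_
    simp [hα]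
  · intro h; exact absurd (Finset.mem_univ _) h

/-- **The planar surface code encodes a qubit: the `X̄`-string is a non-trivial logical operator** of this
sector (`H_X x̄ = 0`, `x̄ ∉ rowsp H_Z` since it anticommutes with the `Z`-cycle `z̄`), of weight `k+2` — so
the distance bound `≥ k+2` is attained and the threshold statements below are not vacuous.
[cite: TillichZemor2014, §3 and Thm 9 (the planar surface code as the product of a repetition code with its transpose)] -/
theorem planarXString_logical (k : ℕ) :
    planarHX k *ᵥ planarXString k = 0 ∧ planarXString k ∉ planarSZ k := by
  refine ⟨planarHX_mulVec_planarXString k, fun hmem => ?_⟩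
  rw [planarSZ, mem_rowSpace_iff] at hmem
  obtain ⟨y, hy⟩ := hmem
  have h1 := planarXString_dotProduct_planarZString k
  rw [← hy, ← Matrix.dotProduct_mulVec, planarHZ_mulVec_planarZString, dotProduct_zero] at h1
  exact zero_ne_one h1

/-- Polynomial size, linear distance: `P(k) r^{k+2} → 0` for every polynomial weight used below.
[cite: DennisEtAl2002, §5.3 (L² μ^L (4p̃)^{L/2} → 0)] -/
private theorem tendsto_poly_mul_pow {r : ℝ} (hr0 : 0 < r) (hr1 : r < 1) (A : ℝ) (m : ℕ) :
    Tendsto (fun k : ℕ => A * ((k : ℝ) + 2) ^ m * r ^ (k + 2)) atTop (𝓝 0) := by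
  have h0 := tendsto_pow_const_mul_const_pow_of_abs_lt_one m
    (show |r| < 1 by rwa [abs_of_nonneg hr0.le])
  have h1 : Tendsto (fun k : ℕ => ((k + 2 : ℕ) : ℝ) ^ m * r ^ (k + 2)) atTop (𝓝 0) :=
    (Filter.tendsto_add_atTop_iff_nat 2).2 h0
  have h2 := h1.const_mul A
  rw [mul_zero] at h2
  refine h2.congr fun k => ?_
  push_cast
  ring

open Classical in
/-- **Certified code-capacity threshold of the planar surface codes** (independent errors of this sector,
EVERY family of minimum-weight decoders): `36 p(1-p) < 1` (`p < p₀(3) = (3-2√2)/6 ≈ .0286`) ⇒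
`Prob_fail → 0`. UNCONDITIONAL. [cite: DumerKovalevPryadko2015, Thm 2 (y = 0; w = 4)] -/
theorem planar_codeCapacityThreshold (D : ∀ k, Decoder (PlanarCheck k → ZMod 2) (PlanarQubit k → ZMod 2))
    (hD : ∀ k, (D k).IsMinWeight (fun e => planarHX k *ᵥ e) {x | planarHX k *ᵥ x = 0} hammingNorm)
    {p : ℝ} (hp0 : 0 ≤ p) (hp : p ≤ 1 / 2) (h36 : 36 * (p * (1 - p)) < 1) :
    Tendsto (fun k => ∑ e ∈ univ.filter (fun e : PlanarQubit k → ZMod 2 =>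
        ¬ (D k).Corrects (fun e => planarHX k *ᵥ e) (planarSZ k : Set (PlanarQubit k → ZMod 2)) e),
        bernoulliWeight p (supp e)) atTop (𝓝 0) := by
  refine codeCapacityThreshold_of_rowWeight' planarHX planarSZ D hD (w := 4) (by norm_num)
    card_rowSupp_planarHX_le (fun k => k + 2) (fun k => by omega) le_hammingNorm_of_planar_cycle ?_ hp0 hp
    (by norm_num; linarith)
  intro r hr0 hr1
  have h := tendsto_poly_mul_pow hr0 hr1 2 2
  refine squeeze_zero (fun k => by positivity) (fun k => ?_) h
  rw [card_planarQubit]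
  have hrk : 0 ≤ r ^ (k + 2) := pow_nonneg hr0.le _
  have hpoly : (((k + 2) ^ 2 + (k + 1) ^ 2 : ℕ) : ℝ) ≤ 2 * ((k : ℝ) + 2) ^ 2 := by
    have hk : (0 : ℝ) ≤ k := Nat.cast_nonneg k
    push_cast
    nlinarith
  exact mul_le_mul_of_nonneg_right hpoly hrk

/-- **Certified erasure threshold of the planar surface codes**: for every loss rate `0 ≤ y < 1/3` the
probability that the erasure pattern is uncorrectable for this sector `→ 0`. UNCONDITIONAL.
[cite: DumerKovalevPryadko2015, Thm 2 (erasure part; w = 4)] -/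
theorem planar_erasureThreshold {y : ℝ} (hy0 : 0 ≤ y) (hy : y < 1 / 3) :
    Tendsto (fun k => ErasureDecoder.uncorrectableProb {x : PlanarQubit k → ZMod 2 | planarHX k *ᵥ x = 0}
      (planarSZ k : Set (PlanarQubit k → ZMod 2)) y) atTop (𝓝 0) := by
  refine erasureThreshold_of_rowWeight' planarHX planarSZ (w := 4) (by norm_num) card_rowSupp_planarHX_le
    (fun k => k + 2) (fun k => by omega) le_hammingNorm_of_planar_cycle ?_ hy0 (by norm_num; linarith)
  intro r hr0 hr1
  have h := tendsto_poly_mul_pow hr0 hr1 2 2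
  refine squeeze_zero (fun k => by positivity) (fun k => ?_) h
  rw [card_planarQubit]
  have hrk : 0 ≤ r ^ (k + 2) := pow_nonneg hr0.le _
  have hpoly : (((k + 2) ^ 2 + (k + 1) ^ 2 : ℕ) : ℝ) ≤ 2 * ((k : ℝ) + 2) ^ 2 := by
    have hk : (0 : ℝ) ≤ k := Nat.cast_nonneg k
    push_cast
    nlinarith
  exact mul_le_mul_of_nonneg_right hpoly hrk

/-- **Certified phenomenological threshold of the planar surface codes** (`q = p`, polynomially many noisy
rounds, EVERY family of minimum-weight space-time decoders): `100 p(1-p) < 1` (`p < p₀(5) ≈ .0101`) ⇒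
`Prob_fail → 0`. UNCONDITIONAL. [cite: DumerKovalevPryadko2015, Thm 3 with p. 5 (w → w + 2; here 4 → 6)] -/
theorem planar_phenomThreshold (T : ℕ → ℕ) (hT : ToricCode.IsPolyBounded T)
    (D : ∀ k, CSSPhenom.STDecoder (PlanarCheck k) (PlanarQubit k) (T k))
    (hD : ∀ k, (D k).IsMinWeight (CSSPhenom.stSyn (planarHX k) (T k))
      (CSSPhenom.stCycles (planarHX k) (T k)) hammingNorm)
    {p : ℝ} (hp0 : 0 ≤ p) (hp : p ≤ 1 / 2) (h100 : 100 * (p * (1 - p)) < 1) :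
    Tendsto (fun k => CSSPhenom.phenomFailureProb (planarHX k) (T k)
      (planarSZ k : Set (PlanarQubit k → ZMod 2)) (D k) p p) atTop (𝓝 0) := by
  refine phenomThreshold_of_rowWeight' planarHX planarSZ T D hD (w := 4) card_rowSupp_planarHX_le
    (fun k => k + 2) (fun k => by omega) le_hammingNorm_of_planar_cycle ?_ hp0 hp (by norm_num; linarith)
  intro r hr0 hr1
  obtain ⟨A, m, hAm⟩ := hT
  have hA0 : 0 ≤ A := by
    have h := hAm 0
    simp only [Nat.cast_zero, zero_add, one_pow, mul_one] at h
    exact le_trans (Nat.cast_nonneg _) h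
  have h := tendsto_poly_mul_pow hr0 hr1 (3 * A) (m + 2)
  refine squeeze_zero (fun k => by positivity) (fun k => ?_) h
  rw [card_planarQubit, card_planarCheck]
  have hrk : 0 ≤ r ^ (k + 2) := pow_nonneg hr0.le _
  have hTk := hAm k
  have hk1 : ((k : ℝ) + 1) ^ m ≤ ((k : ℝ) + 2) ^ m :=
    pow_le_pow_left₀ (by positivity) (by linarith) m
  have hTk' : (T k : ℝ) ≤ A * ((k : ℝ) + 2) ^ m := hTk.trans (mul_le_mul_of_nonneg_left hk1 hA0)
  have hsize : ((((k + 2) ^ 2 + (k + 1) ^ 2 + (k + 1) * (k + 2)) * T k : ℕ) : ℝ) ≤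
      3 * A * ((k : ℝ) + 2) ^ (m + 2) := by
    push_cast
    have hpoly : (((k : ℝ) + 2) ^ 2 + ((k : ℝ) + 1) ^ 2 + ((k : ℝ) + 1) * ((k : ℝ) + 2)) ≤
        3 * ((k : ℝ) + 2) ^ 2 := by
      have hk : (0 : ℝ) ≤ k := Nat.cast_nonneg k
      nlinarith
    have hT0 : 0 ≤ (T k : ℝ) := Nat.cast_nonneg _
    calc (((k : ℝ) + 2) ^ 2 + ((k : ℝ) + 1) ^ 2 + ((k : ℝ) + 1) * ((k : ℝ) + 2)) * (T k : ℝ)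
        ≤ 3 * ((k : ℝ) + 2) ^ 2 * (A * ((k : ℝ) + 2) ^ m) :=
          mul_le_mul hpoly hTk' hT0 (by positivity)
      _ = 3 * A * ((k : ℝ) + 2) ^ (m + 2) := by ring
  exact mul_le_mul_of_nonneg_right hsize hrk

/-! #### The second sector (errors detected by `H_Z`, trivial iff in `rowsp H_X`) -/

/-- `Z`-checks (chambers `E₁ × E₂`) of the `k`-th planar surface code. [cite: TillichZemor2014, §3] -/
abbrev PlanarZCheck (k : ℕ) : Type := Fin (k + 2) × Fin (k + 1)

/-- `H_Z` of the planar surface code `HGP(H, Hᵀ)`. [cite: TillichZemor2014, §3-§4 (H_Z of the product hypergraph)] -/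
def planarHZ (k : ℕ) : Matrix (PlanarZCheck k) (PlanarQubit k) (ZMod 2) :=
  HypergraphProduct.zMatrix (repMatrix (k + 1)) (repMatrix (k + 1))ᵀ

/-- The trivial errors of the second sector: the row space of `H_X`. [cite: TillichZemor2014, §3-§4] -/
def planarSX (k : ℕ) : Submodule (ZMod 2) (PlanarQubit k → ZMod 2) :=
  rowSpace (planarHX k)

/-- The planar `Z`-checks have weight `≤ 4` (`2` from a column of `H`, `2` from a column of `Hᵀ` = a row of
`H`). [cite: TillichZemor2014, §3 (|C_{αβ}| = |α| + |β|; here 2 + 2)] -/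
theorem card_rowSupp_planarHZ_le (k : ℕ) (x : PlanarZCheck k) : (rowSupp (planarHZ k) x).card ≤ 4 :=
  HypergraphProduct.card_rowSupp_zMatrix_le _ _ (fun α => hammingNorm_repMatrix_col_le (k + 1) α)
    (fun β => hammingNorm_repMatrix_row_le (k + 1) β) x

/-- **Distance `≥ k+2` of the second sector** (TZ Thm 9, cocycle half: `d(ker Hᵀ) = ∞`,
`d(ker (Hᵀ)ᵀ) = d(ker H) = k+2`). [cite: TillichZemor2014, Thm 9] -/
theorem le_hammingNorm_of_planar_cocycle (k : ℕ) (x : PlanarQubit k → ZMod 2) (hx : planarHZ k *ᵥ x = 0)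
    (hxS : x ∉ planarSX k) : k + 2 ≤ hammingNorm x :=
  HypergraphProduct.le_hammingNorm_of_cocycle _ _
    (by rw [pcCode_repMatrix_transpose_eq_bot, Coding.minDist_bot]; exact le_top)
    (by rw [Matrix.transpose_transpose]; exact le_minDist_pcCode_repMatrix (k + 1)) x hx hxS

/-- **The `Z̄`-string is a non-trivial logical of the second sector** (`H_Z z̄ = 0`, `z̄ ∉ rowsp H_X` since
`x̄ · z̄ = 1` and `H_X x̄ = 0`). [cite: TillichZemor2014, §3 (logical operators of the surface code)] -/
theorem planarZString_logical (k : ℕ) :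
    planarHZ k *ᵥ planarZString k = 0 ∧ planarZString k ∉ planarSX k := by
  refine ⟨planarHZ_mulVec_planarZString k, fun hmem => ?_⟩
  rw [planarSX, mem_rowSpace_iff] at hmem
  obtain ⟨y, hy⟩ := hmem
  have h1 := planarXString_dotProduct_planarZString k
  rw [dotProduct_comm, ← hy, ← Matrix.dotProduct_mulVec, planarHX_mulVec_planarXString, dotProduct_zero] at h1
  exact zero_ne_one h1

/-- The `k`-th planar surface code has `(k+2)(k+1)` `Z`-checks. [cite: TillichZemor2014, §3 (chamber count)] -/
theorem card_planarZCheck (k : ℕ) : Fintype.card (PlanarZCheck k) = (k + 2) * (k + 1) := by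
  simp only [Fintype.card_prod, Fintype.card_fin]

open Classical in
/-- **Second sector, code capacity**: `36 p(1-p) < 1` ⇒ `Prob_fail → 0` for EVERY family of minimum-weight
decoders of the `H_Z`-detected sector. UNCONDITIONAL. [cite: DumerKovalevPryadko2015, Thm 2 (y = 0; w = 4)] -/
theorem planar_codeCapacityThreshold' (D : ∀ k, Decoder (PlanarZCheck k → ZMod 2) (PlanarQubit k → ZMod 2))
    (hD : ∀ k, (D k).IsMinWeight (fun e => planarHZ k *ᵥ e) {x | planarHZ k *ᵥ x = 0} hammingNorm)
    {p : ℝ} (hp0 : 0 ≤ p) (hp : p ≤ 1 / 2) (h36 : 36 * (p * (1 - p)) < 1) :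
    Tendsto (fun k => ∑ e ∈ univ.filter (fun e : PlanarQubit k → ZMod 2 =>
        ¬ (D k).Corrects (fun e => planarHZ k *ᵥ e) (planarSX k : Set (PlanarQubit k → ZMod 2)) e),
        bernoulliWeight p (supp e)) atTop (𝓝 0) := by
  refine codeCapacityThreshold_of_rowWeight' planarHZ planarSX D hD (w := 4) (by norm_num)
    card_rowSupp_planarHZ_le (fun k => k + 2) (fun k => by omega) le_hammingNorm_of_planar_cocycle ?_ hp0 hp
    (by norm_num; linarith)
  intro r hr0 hr1
  have h := tendsto_poly_mul_pow hr0 hr1 2 2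
  refine squeeze_zero (fun k => by positivity) (fun k => ?_) h
  rw [card_planarQubit]
  have hrk : 0 ≤ r ^ (k + 2) := pow_nonneg hr0.le _
  have hpoly : (((k + 2) ^ 2 + (k + 1) ^ 2 : ℕ) : ℝ) ≤ 2 * ((k : ℝ) + 2) ^ 2 := by
    have hk : (0 : ℝ) ≤ k := Nat.cast_nonneg k
    push_cast
    nlinarith
  exact mul_le_mul_of_nonneg_right hpoly hrk

/-- **Second sector, erasures**: `y < 1/3` ⇒ uncorrectable-erasure probability `→ 0`. UNCONDITIONAL.
[cite: DumerKovalevPryadko2015, Thm 2 (erasure part; w = 4)] -/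
theorem planar_erasureThreshold' {y : ℝ} (hy0 : 0 ≤ y) (hy : y < 1 / 3) :
    Tendsto (fun k => ErasureDecoder.uncorrectableProb {x : PlanarQubit k → ZMod 2 | planarHZ k *ᵥ x = 0}
      (planarSX k : Set (PlanarQubit k → ZMod 2)) y) atTop (𝓝 0) := by
  refine erasureThreshold_of_rowWeight' planarHZ planarSX (w := 4) (by norm_num) card_rowSupp_planarHZ_le
    (fun k => k + 2) (fun k => by omega) le_hammingNorm_of_planar_cocycle ?_ hy0 (by norm_num; linarith)
  intro r hr0 hr1
  have h := tendsto_poly_mul_pow hr0 hr1 2 2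
  refine squeeze_zero (fun k => by positivity) (fun k => ?_) h
  rw [card_planarQubit]
  have hrk : 0 ≤ r ^ (k + 2) := pow_nonneg hr0.le _
  have hpoly : (((k + 2) ^ 2 + (k + 1) ^ 2 : ℕ) : ℝ) ≤ 2 * ((k : ℝ) + 2) ^ 2 := by
    have hk : (0 : ℝ) ≤ k := Nat.cast_nonneg k
    push_cast
    nlinarith
  exact mul_le_mul_of_nonneg_right hpoly hrk

/-- **Second sector, noisy measurement** (`q = p`, polynomially many rounds, every minimum-weight space-time
decoder family): `100 p(1-p) < 1` ⇒ `Prob_fail → 0`. UNCONDITIONAL.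
[cite: DumerKovalevPryadko2015, Thm 3 with p. 5 (w → w + 2)] -/
theorem planar_phenomThreshold' (T : ℕ → ℕ) (hT : ToricCode.IsPolyBounded T)
    (D : ∀ k, CSSPhenom.STDecoder (PlanarZCheck k) (PlanarQubit k) (T k))
    (hD : ∀ k, (D k).IsMinWeight (CSSPhenom.stSyn (planarHZ k) (T k))
      (CSSPhenom.stCycles (planarHZ k) (T k)) hammingNorm)
    {p : ℝ} (hp0 : 0 ≤ p) (hp : p ≤ 1 / 2) (h100 : 100 * (p * (1 - p)) < 1) :
    Tendsto (fun k => CSSPhenom.phenomFailureProb (planarHZ k) (T k)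
      (planarSX k : Set (PlanarQubit k → ZMod 2)) (D k) p p) atTop (𝓝 0) := by
  refine phenomThreshold_of_rowWeight' planarHZ planarSX T D hD (w := 4) card_rowSupp_planarHZ_le
    (fun k => k + 2) (fun k => by omega) le_hammingNorm_of_planar_cocycle ?_ hp0 hp (by norm_num; linarith)
  intro r hr0 hr1
  obtain ⟨A, m, hAm⟩ := hT
  have hA0 : 0 ≤ A := by
    have h := hAm 0
    simp only [Nat.cast_zero, zero_add, one_pow, mul_one] at h
    exact le_trans (Nat.cast_nonneg _) h
  have h := tendsto_poly_mul_pow hr0 hr1 (3 * A) (m + 2)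
  refine squeeze_zero (fun k => by positivity) (fun k => ?_) h
  rw [card_planarQubit, card_planarZCheck]
  have hrk : 0 ≤ r ^ (k + 2) := pow_nonneg hr0.le _
  have hTk := hAm k
  have hk1 : ((k : ℝ) + 1) ^ m ≤ ((k : ℝ) + 2) ^ m :=
    pow_le_pow_left₀ (by positivity) (by linarith) m
  have hTk' : (T k : ℝ) ≤ A * ((k : ℝ) + 2) ^ m := hTk.trans (mul_le_mul_of_nonneg_left hk1 hA0)
  have hsize : ((((k + 2) ^ 2 + (k + 1) ^ 2 + (k + 2) * (k + 1)) * T k : ℕ) : ℝ) ≤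
      3 * A * ((k : ℝ) + 2) ^ (m + 2) := by
    push_cast
    have hpoly : (((k : ℝ) + 2) ^ 2 + ((k : ℝ) + 1) ^ 2 + ((k : ℝ) + 2) * ((k : ℝ) + 1)) ≤
        3 * ((k : ℝ) + 2) ^ 2 := by
      have hk : (0 : ℝ) ≤ k := Nat.cast_nonneg k
      nlinarith
    have hT0 : 0 ≤ (T k : ℝ) := Nat.cast_nonneg _
    calc (((k : ℝ) + 2) ^ 2 + ((k : ℝ) + 1) ^ 2 + ((k : ℝ) + 2) * ((k : ℝ) + 1)) * (T k : ℝ)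
        ≤ 3 * ((k : ℝ) + 2) ^ 2 * (A * ((k : ℝ) + 2) ^ m) :=
          mul_le_mul hpoly hTk' hT0 (by positivity)
      _ = 3 * A * ((k : ℝ) + 2) ^ (m + 2) := by ring
  exact mul_le_mul_of_nonneg_right hsize hrk

end Planar

end Literature.InformationTheory.QuantumCodes
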